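import Summits.Ventures.PercRepro.RankLevelSetLevelSixBasisCell
import Summits.Ventures.PercRepro.RankLevelSetLevelSixCapGlue25
import Summits.Ventures.PercRepro.RankLevelSetLevelSixArithBasisSq17A

/-!
# PercRepro — THE 17 ROW, CORANKS `41 … 41`: THE BASIS CELLS (p8 g15, S3)

`proofs/SUBCLAIM-S3-p8.md` §3z⁗⁗⁗″. The core cells `(17, d)`, `41 ≤ d ≤ 41`, on THE BASIS CELL `c025_core_six_basis_cell` (RankLevelSetLevelSixBasisCell, p8 g10: the light class by the basis device, the heavy windows, the level-by-level tail) with the numerals of RankLevelSetLevelSixArithBasisSq17A (`tools/gen_basis23.py`; ratios 0.988). Axioms: standard.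
-/

open scoped Matroid

namespace PercRepro

namespace ThmN

open Set

variable {α : Type}

set_option maxHeartbeats 6000000 in
/-- **The core cells `(17, d)` for `41 ≤ d ≤ 41`** on the basis cell. -/
theorem c025_core_six_t17_basis_mid1a (M : Matroid α) [M.Finite] (d : ℕ) (hdlo : 41 ≤ d) (hdhi : d ≤ 41)
    (hR : M.eRank = (17 : ℕ∞)) (hn : M.E.ncard = 17 + d)
    (hfree : ∀ e ∈ M.E, ∃ A ⊆ M.E \ {e}, e ∉ M.closure A ∧ e ∉ M.closure ((M.E \ {e}) \ A)) :
    RLS M 17 6 := by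
  classical
  have hEcard : M.ground_finite.toFinset.card = 17 + d := by
    rw [← Set.ncard_eq_toFinset_card _ M.ground_finite]; exact hn
  have hd : M.E.encard = M.eRank + d := by
    rw [hR, ← M.ground_finite.cast_ncard_eq, hn]
    push_cast
    ring
  have hsp : ({X : Set α | X ⊆ M.E ∧ M.eRk X = M.eRank}.ncard : ℚ) ≤
      ∑ j ∈ Finset.range (d + 1), (((17 + d).choose j : ℕ) : ℚ) := by
    have := Matroid.ncard_spanning_le (M := M) hd
    rw [hEcard] at this
    exact_mod_cast this
  have hΦ : phiK 17 6 ≤ (2 : ℚ) ^ (17 + 6) / (((17 + 6).choose 6 : ℕ) : ℚ) := phiK_le_two_pow_div_six 17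
  rw [RLS_iff]
  interval_cases d
  · refine c025_core_six_basis_cell M 17 41 28 1 1 39 0 1000426 1000000 ((17 + 6).choose 6) (Nat.choose_pos (by norm_num))
      (phiK 17 6) hΦ (by norm_num) (by norm_num) _ hsp (by norm_num) (by norm_num) (by norm_num) (by norm_num) (by norm_num)
      (by norm_num [cnull]) (by norm_num [cnull]) (Or.inr ⟨by norm_num, by norm_num⟩) (Or.inr (Or.inr (by norm_num)))
      (by norm_num) (by norm_num) (4294825159 / 191268 : ℚ) (4294825159 / 191268 : ℚ) (by norm_num) (by norm_num)
      ?_ ?_ ?_ hR hn hfree ?_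
    · exact basis_sq17_G_41
    · exact basis_sq17_Gp_41
    · exact basis_sq17_tail_41
    · exact basis_sq17_poly_41

end ThmN

end PercRepro
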